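import Literature.Computability.AlgebraicComplexity.DIP20HookLikeTails
import Literature.Computability.AlgebraicComplexity.DIP20ChowUpperBoundProofs
import HarnessLib

/-!
# Dörfler–Ikenmeyer–Panova 2019, Prop. 3.15 (occurrence obstructions `Pow_{m,d}^n ⊄ Ch_m^n` exist)
# assembled from Lemma 3.4 and the printed plethysm table

Topic `Literature/Computability/AlgebraicComplexity`; sibling proofs file (D-0014) of
`DIP20MultiplicityObstructions.lean` (named facts `DIP20_prop_3_15`, `DIP20_prop_3_15_table`,
`DIP20_lem_3_4`; its §J `DIP20_prop_3_15_powerSum_pos_of_table` already derives the power-sum column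
from Prop. 3.3 and the table). Theorems only, no new facts.

J. Dörfler, C. Ikenmeyer, G. Panova, SIAM J. Appl. Algebra Geom. 4 (2020) = arXiv:1901.04576, Prop. 3.15
(arXiv pp. 7–8; TeX `multobs.tex` L513 `{pro:occobsdoexist}`): the rows `(m,n,λ,d) = (3,2,(2,2,2),3)`,
`(3,3,(7,3,2),4)`, `(3,4,(11,9,8),7)`, `(3,5,(12,9,9),6)`, `(4,6,(14,14,13,13),9)` have
`mult_λ(ℂ[Ch_m^n]_d) = 0 < mult_λ(ℂ[Pow_{m,d}^n]_d)`; printed proof: "Lemma 3.4 implies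
`mult_λ(ℂ[Ch_m^n]_d) ≤ a_λ(n[d]) = 0`. Proposition 3.3 implies `mult_λ(ℂ[Pow_{m,d}^n]_d) > 0`."

**`DIP20_prop_3_15_of_lem_3_4`** formalises exactly this deduction: from Lemma 3.4 in its GUARDED form
(`mult ≤ a_λ(n[d])`, printed range `n ≥ m`, inner degree `d ≥ 1` — spelled out as the hypothesis `h34`,
word for word the statement of the named fact `DIP20_lem_3_4` with the guard `0 < d`: printed Lemma 3.4
concerns `ℂ[Ch_m^n]_d` for `d ≥ 1`, and at inner degree `0` the tree's `plethysmCoeffOfPartition ℂ m 0 ∅` is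
the `finrank` junk `0` while `mult_∅ ℂ[Ch]_0 = 1`, so the unguarded sentence is false at `d = 0`;
bip referee rows 70/73, lead-bip ruling (k)), the table `DIP20_prop_3_15_table` (`a_λ(n[d]) = 0`,
`a_λ(d[n]) > 0`), and — for the first row, where `n = 2 < m = 3` lies outside Lemma 3.4's printed
hypothesis (`Ch_3^2` = ternary quadrics of rank `≤ 2`, on which the discriminant, the highest-weight
vector of type `(2,2,2)`, vanishes) — the Chow side of row 1 as an explicit hypothesis. The dictionary
`rowDual ![λ…] = λ^*` of an explicit partition goes through `partitionOfList` of
`DIP20HookLikeTails.lean`.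

**Row 1 PROVED** (`coordRingMultiplicity_chowSet_three_two_222`, characteristic zero): every
highest-weight vector `F` of type `(2,2,2)` in `k[Sym² k³]` vanishes on `Ch_3^2`. Mechanism (elementary,
in place of "the discriminant vanishes on rank-`≤ 2` quadrics"): for `q = ℓ_a ℓ_c` with
`w₀ = a₁c₂ - a₂c₁ ≠ 0` the upper triangular `b = 1 + w₀⁻¹ e₀ (a × c)ᵀ` fixes `ℓ_a` and `ℓ_c` and has
diagonal `(2,1,1)`, so `χ(b) F(q) = (b · F)(q) = F(b⁻¹ · q) = F(q)` with `χ(b) = 2⁻² ≠ 1` forces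
`F(q) = 0` (`aeval_formCoeff_eq_zero_of_mem_highestWeightSpace_of_fixed`); the generic vanishing
spreads to all of `Ch_3^2` because `I(Ch_3^2)` is the kernel of the comorphism into the domain `k[Y]`
(`vanishingIdeal_chowSet_eq_ker` of the statement file). Hence
`DIP20_prop_3_15_of_lem_3_4_of_table : DIP20_lem_3_4 → DIP20_prop_3_15_table → DIP20_prop_3_15`; and
since Lemma 3.4 is a theorem of the tree (`DIP20_lem_3_4_holds`, `DIP20ChowUpperBoundProofs.lean`),
**`DIP20_prop_3_15_of_table : DIP20_prop_3_15_table → DIP20_prop_3_15`** and the certificate interface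
**`DIP20_prop_3_15_of_plethysm_bounds`** (five positivity + four vanishing plethysm values ⇒ Prop. 3.15).

## References

* J. Dörfler, C. Ikenmeyer, G. Panova, SIAM J. Appl. Algebra Geom. 4 (2020) = arXiv:1901.04576,
  Prop. 3.15 and its proof, Lemma 3.4, Prop. 3.3. [key `DorflerIkenmeyerPanova2020`]
-/

namespace Literature.Computability.AlgebraicComplexity

open _root_.Literature.NumberTheory.DiophantineGeometry

section Prop315

/-- **One row of Prop. 3.15, Chow side, from Lemma 3.4 and a vanishing `a_λ(n[d]) = 0`**: for an
explicit `m`-partition `λ` (a weakly decreasing list `l` of positive parts of length `≤ m`, sum `d·n`)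
with `m ≤ n` and `0 < d`, `mult_λ(ℂ[Ch_m^n]_d) ≤ a_λ(n[d])`; so `a_λ(n[d]) = 0` forces `mult = 0`. The
hypothesis `h34` is Lemma 3.4 in its guarded form (inner degree `d ≥ 1`; = the named fact `DIP20_lem_3_4`
of the statement file once it carries the `0 < d` guard — at `d = 0` the unguarded sentence is false,
`mult_∅ ℂ[Ch]_0 = 1 > 0 =` junk `plethysmCoeffOfPartition ℂ m 0 ∅`).
[cite: DorflerIkenmeyerPanova2020, Prop. 3.15 (proof: "Lemma 3.4 implies mult ≤ a_λ(n[d]) = 0", arXiv p. 8)] -/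
theorem coordRingMultiplicity_chowSet_eq_zero_of_lem_3_4
    (h34 : ∀ (m n d : ℕ), m ≤ n → 0 < d → ∀ lam : Nat.Partition (d * n), lam.parts.card ≤ m →
      coordRingMultiplicity ℂ (chowSet ℂ m n) n (Weight.dualOfPartition m lam) ≤
        plethysmCoeffOfPartition ℂ m d lam)
    {m n d : ℕ} (hmn : m ≤ n) (hd : 0 < d) (l : List ℕ) (hpos : ∀ x ∈ l, 0 < x)
    (hsorted : l.Pairwise (· ≥ ·)) (hlen : l.length ≤ m)
    (hsum : l.sum = d * n) (μ : Fin m → ℕ) (hμ : ∀ i : Fin m, μ i = l.getD i 0)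
    (ha : plethysmCoeff ℂ (Fin m) d (rowDual μ) = 0) :
    coordRingMultiplicity ℂ (chowSet ℂ m n) n (rowDual μ) = 0 := by
  let lam : Nat.Partition (d * n) :=
    ⟨(partitionOfList l hpos).parts, (partitionOfList l hpos).parts_pos, by
      rw [(partitionOfList l hpos).parts_sum, hsum]⟩
  have hs : lam.sortedParts = l := sortedParts_partitionOfList l hpos hsorted
  have hcard : lam.parts.card ≤ m := by
    show (partitionOfList l hpos).parts.card ≤ m
    rw [card_parts_partitionOfList]
    exact hlen
  have hχ : rowDual μ = Weight.dualOfPartition m lam := by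
    have hfun : μ = fun i : Fin m => lam.sortedParts.getD i 0 := funext fun i => by rw [hμ, hs]
    rw [hfun]
    rfl
  have hle := h34 m n d hmn hd lam hcard
  rw [plethysmCoeffOfPartition, ← hχ, ha] at hle
  exact Nat.le_zero.mp hle

/-- **Prop. 3.15 assembled** ("The following partitions give occurrence obstructions that show
`Pow_{m,d}^n ⊄ Ch_m^n`", arXiv pp. 7–8), along the printed proof: the Chow sides of rows 2–5 from
Lemma 3.4 (hypothesis `h34` = the GUARDED statement, inner degree `d ≥ 1`; rows 2–5 have `d = 4, 7, 6, 9`)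
and the table values `a_λ(n[d]) = 0`
(`DIP20_prop_3_15_table`); the power-sum sides from Prop. 3.3 and the table values `a_λ(d[n]) > 0`
(`DIP20_prop_3_15_powerSum_pos_of_table`); the Chow side of row 1 (`n = 2 < m = 3`, outside Lemma 3.4's
printed range) as a hypothesis. [cite: DorflerIkenmeyerPanova2020, Prop. 3.15 (arXiv pp. 7–8; TeX multobs.tex L513 {pro:occobsdoexist}; held paper-arxiv-1901.04576 p0008.txt:L18 "Proposition 13")] -/
theorem DIP20_prop_3_15_of_lem_3_4
    (h34 : ∀ (m n d : ℕ), m ≤ n → 0 < d → ∀ lam : Nat.Partition (d * n), lam.parts.card ≤ m →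
      coordRingMultiplicity ℂ (chowSet ℂ m n) n (Weight.dualOfPartition m lam) ≤
        plethysmCoeffOfPartition ℂ m d lam)
    (htab : DIP20_prop_3_15_table)
    (hrow1 : coordRingMultiplicity ℂ (chowSet ℂ 3 2) 2 (rowDual ![2, 2, 2]) = 0) : DIP20_prop_3_15 := by
  obtain ⟨p1, p2, p3, p4, p5⟩ := DIP20_prop_3_15_powerSum_pos_of_table htab
  obtain ⟨-, ⟨-, a2⟩, ⟨-, a3⟩, ⟨-, a4⟩, ⟨-, a5⟩⟩ := htab
  refine ⟨⟨hrow1, p1⟩, ⟨?_, p2⟩, ⟨?_, p3⟩, ⟨?_, p4⟩, ⟨?_, p5⟩⟩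
  · refine coordRingMultiplicity_chowSet_eq_zero_of_lem_3_4 h34 le_rfl (by norm_num) [7, 3, 2] ?_ ?_
      (by simp) (by simp) _ ?_ a2
    · intro x hx; simp at hx; omega
    · simp
    · intro i; fin_cases i <;> rfl
  · refine coordRingMultiplicity_chowSet_eq_zero_of_lem_3_4 h34 (by norm_num) (by norm_num)
      [11, 9, 8] ?_ ?_ (by simp) (by simp) _ ?_ a3
    · intro x hx; simp at hx; omega
    · simp
    · intro i; fin_cases i <;> rfl
  · refine coordRingMultiplicity_chowSet_eq_zero_of_lem_3_4 h34 (by norm_num) (by norm_num)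
      [12, 9, 9] ?_ ?_ (by simp) (by simp) _ ?_ a4
    · intro x hx; simp at hx; omega
    · simp
    · intro i; fin_cases i <;> rfl
  · refine coordRingMultiplicity_chowSet_eq_zero_of_lem_3_4 h34 (by norm_num) (by norm_num)
      [14, 14, 13, 13] ?_ ?_ (by simp) (by simp) _ ?_ a5
    · intro x hx; simp at hx; omega
    · simp
    · intro i; fin_cases i <;> rfl

end Prop315

/-! ### Prop. 3.15, row 1 (`n = 2 < m = 3`): the Chow side PROVED by a Borel-stabilizer argument -/

section Row1

open MvPolynomial

variable {k : Type} [Field k]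

/-- The substitution `A` maps the linear form `ℓ_a = Σ_j a_j x_j` to `ℓ_{A a}` (tree convention
`x_i ↦ Σ_j A_{ji} x_j`, `linSubst_X`). [cite: Landsberg2017, §1.2] -/
theorem linSubst_linearForm_eq {m : ℕ} (A : Matrix (Fin m) (Fin m) k) (a : Fin m → k) :
    linSubst (Fin m) k A (linearForm a) = linearForm (A.mulVec a) := by
  simp only [linearForm, map_sum, map_mul, linSubst_C, linSubst_X, Finset.mul_sum, smul_eq_C_mul]
  rw [Finset.sum_comm]
  refine Finset.sum_congr rfl fun i _ => ?_
  rw [Matrix.mulVec, dotProduct, map_sum, Finset.sum_mul]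
  refine Finset.sum_congr rfl fun j _ => ?_
  rw [map_mul]
  ring

/-- **A highest-weight vector vanishes at every point fixed by a Borel element on which its
character is not `1`.** If `F ∈ HWV_χ(k[Sym^n k^σ])`, `b` is upper triangular with `b · q = q` and
`χ(b) ≠ 1`, then `F(q) = 0` (`χ(b) F(q) = (b · F)(q) = F(b⁻¹ · q) = F(q)`). This elementary weight
argument is used below in place of the printed "the discriminant vanishes on rank-`≤ 2` quadrics"
(DIP Prop. 3.15, row 1). [cite: DorflerIkenmeyerPanova2020, Prop. 3.15 (row 1, arXiv p. 8)] -/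
theorem aeval_formCoeff_eq_zero_of_mem_highestWeightSpace_of_fixed {σ : Type} [Fintype σ] [LinearOrder σ]
    {n : ℕ} {χ : Weight σ} {F : MvPolynomial (DegIdx σ n) k}
    (hF : F ∈ highestWeightSpace (coordRep σ k n) χ) {b : GL σ k} (hb : IsUpperTriangular b)
    {q : MvPolynomial σ k} (hq : linSubstRep σ k b q = q) (hχ : weightChar χ b ≠ 1) :
    aeval (formCoeff n q) F = 0 := by
  have h := (mem_highestWeightSpace_iff _ _ _).mp hF b hb
  rw [coordRep_apply] at h
  have h' := congrArg (aeval (formCoeff n q)) h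
  rw [aeval_formCoeff_coordSubst, map_smul, smul_eq_mul] at h'
  have hq' : linSubstRep σ k b⁻¹ q = q := by
    conv_lhs => rw [← hq]
    rw [← Module.End.mul_apply, ← map_mul, inv_mul_cancel, map_one, Module.End.one_apply]
  rw [hq'] at h'
  -- h' : aeval _ F = weightChar χ b * aeval _ F
  have : (weightChar χ b - 1) * aeval (formCoeff n q) F = 0 := by rw [sub_mul, one_mul, ← h', sub_self]
  rcases mul_eq_zero.mp this with h0 | h0
  · exact absurd (sub_eq_zero.mp h0) hχ
  · exact h0

/-- The Borel element used for `Ch_3^2`: for ternary linear forms `ℓ_a, ℓ_c` with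
`w₀ = a₁c₂ - a₂c₁ ≠ 0`, the upper triangular matrix `B = 1 + w₀⁻¹ e₀ wᵀ` (`w = a × c`), which
fixes `a` and `c` and has diagonal `(2, 1, 1)`. [folklore] -/
private def row1Matrix (a c : Fin 3 → k) : Matrix (Fin 3) (Fin 3) k :=
  !![2, (a 1 * c 2 - a 2 * c 1)⁻¹ * (a 2 * c 0 - a 0 * c 2),
      (a 1 * c 2 - a 2 * c 1)⁻¹ * (a 0 * c 1 - a 1 * c 0);
    0, 1, 0;
    0, 0, 1]

/-- `det B = 2`. [folklore] -/
private theorem row1Matrix_det (a c : Fin 3 → k) : (row1Matrix a c).det = 2 := by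
  rw [row1Matrix, Matrix.det_fin_three]
  simp

/-- `B a = a` (`(a × c) · a = 0`). [folklore] -/
private theorem row1Matrix_mulVec_left {a c : Fin 3 → k} (hw : a 1 * c 2 - a 2 * c 1 ≠ 0) :
    (row1Matrix a c).mulVec a = a := by
  ext i
  fin_cases i
  · simp [row1Matrix, Matrix.mulVec, dotProduct, Fin.sum_univ_three]
    field_simp
    ring
  · simp [row1Matrix, Matrix.mulVec, dotProduct, Fin.sum_univ_three]
  · simp [row1Matrix, Matrix.mulVec, dotProduct, Fin.sum_univ_three]

/-- `B c = c` (`(a × c) · c = 0`). [folklore] -/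
private theorem row1Matrix_mulVec_right {a c : Fin 3 → k} (hw : a 1 * c 2 - a 2 * c 1 ≠ 0) :
    (row1Matrix a c).mulVec c = c := by
  ext i
  fin_cases i
  · simp [row1Matrix, Matrix.mulVec, dotProduct, Fin.sum_univ_three]
    field_simp
    ring
  · simp [row1Matrix, Matrix.mulVec, dotProduct, Fin.sum_univ_three]
  · simp [row1Matrix, Matrix.mulVec, dotProduct, Fin.sum_univ_three]

variable [CharZero k]

/-- **Generic vanishing**: a highest-weight vector of weight `(2,2,2)^* = (-2,-2,-2)` in
`k[Sym² k³]` vanishes at `ℓ_a ℓ_c` whenever `a₁c₂ - a₂c₁ ≠ 0` (characteristic zero).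
[cite: DorflerIkenmeyerPanova2020, Prop. 3.15 (row 1, arXiv p. 8)] -/
theorem aeval_formCoeff_linearForm_mul_eq_zero_of_ne {F : MvPolynomial (DegIdx (Fin 3) 2) k}
    (hF : F ∈ highestWeightSpace (coordRep (Fin 3) k 2) (rowDual ![2, 2, 2])) {a c : Fin 3 → k}
    (hw : a 1 * c 2 - a 2 * c 1 ≠ 0) :
    aeval (formCoeff 2 (linearForm a * linearForm c)) F = 0 := by
  have hdet : (row1Matrix a c).det ≠ 0 := by rw [row1Matrix_det]; exact two_ne_zero
  let b : GL (Fin 3) k := Matrix.GeneralLinearGroup.mkOfDetNeZero _ hdet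
  have hbval : (b : Matrix (Fin 3) (Fin 3) k) = row1Matrix a c :=
    Matrix.GeneralLinearGroup.val_mkOfDetNeZero _ _
  have hb : IsUpperTriangular b := by
    intro i j hij
    rw [hbval]
    fin_cases i <;> fin_cases j <;> simp [row1Matrix] at hij ⊢
  refine aeval_formCoeff_eq_zero_of_mem_highestWeightSpace_of_fixed hF hb ?_ ?_
  · rw [linSubstRep_apply, map_mul, linSubst_linearForm_eq, linSubst_linearForm_eq, hbval,
      row1Matrix_mulVec_left hw, row1Matrix_mulVec_right hw]
  · rw [weightChar, Fin.prod_univ_three, hbval]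
    simp [row1Matrix, rowDual, Weight.dual]
    norm_num

/-- **Every highest-weight vector of type `(2,2,2)` in `k[Sym² k³]` vanishes on `Ch_3^2`** (products
of two ternary linear forms = quadrics of rank `≤ 2`): generic vanishing (`a₁c₂ - a₂c₁ ≠ 0`) and the
irreducibility of the parametrisation `(a, c) ↦ ℓ_a ℓ_c` (`I(Ch_3^2)` is the kernel of the comorphism
into the domain `k[Y]`, `vanishingIdeal_chowSet_eq_ker`). In print: "the type `(2,2,2)` is the
discriminant, which vanishes on them" (DIP Prop. 3.15, row 1). [cite: DorflerIkenmeyerPanova2020, Prop. 3.15 (row 1, arXiv p. 8)] -/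
theorem mem_vanishingIdeal_chowSet_three_two_of_mem_highestWeightSpace
    {F : MvPolynomial (DegIdx (Fin 3) 2) k}
    (hF : F ∈ highestWeightSpace (coordRep (Fin 3) k 2) (rowDual ![2, 2, 2])) :
    F ∈ MvPolynomial.vanishingIdeal k (formCoeff 2 '' chowSet k 3 2) := by
  haveI : Infinite k := CharZero.infinite k
  rw [vanishingIdeal_chowSet_eq_ker, RingHom.mem_ker]
  set Φ := (aeval (fun e : DegIdx (Fin 3) 2 => coeff e.1 (genericChowProduct (k := k) 3 2)) :
    MvPolynomial (DegIdx (Fin 3) 2) k →ₐ[k] MvPolynomial (Fin 2 × Fin 3) k) with hΦ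
  -- the generic minor `w₀ = Y₀₁ Y₁₂ - Y₀₂ Y₁₁`
  set W : MvPolynomial (Fin 2 × Fin 3) k := X (0, 1) * X (1, 2) - X (0, 2) * X (1, 1) with hW
  have hW0 : W ≠ 0 := by
    intro h
    have h1 := congrArg (eval fun ij : Fin 2 × Fin 3 => if ij = (0, 1) ∨ ij = (1, 2) then (1 : k) else 0) h
    rw [hW, map_sub, map_mul, map_mul, eval_X, eval_X, eval_X, eval_X, map_zero] at h1
    simp at h1
  have hprod : Φ F * W = 0 := by
    apply MvPolynomial.funext
    intro y
    rw [map_mul, map_zero]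
    by_cases hy : eval y W = 0
    · rw [hy, mul_zero]
    · have hy' : y (0, 1) * y (1, 2) - y (0, 2) * y (1, 1) ≠ 0 := by
        rw [hW, map_sub, map_mul, map_mul, eval_X, eval_X, eval_X, eval_X] at hy
        exact hy
      rw [hΦ, ← aeval_eq_eval, aeval_genericChowMap 3 2 F (fun i j => y (i, j)), Fin.prod_univ_two,
        aeval_formCoeff_linearForm_mul_eq_zero_of_ne hF hy', zero_mul]
  exact (mul_eq_zero.mp hprod).resolve_right hW0

/-- **Prop. 3.15, row 1, Chow side** (`(m,n,λ,d) = (3,2,(2,2,2),3)`): `mult_{(2,2,2)}(k[Ch_3^2]_3) = 0`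
— PROVED (characteristic zero): every highest-weight vector of that type vanishes on `Ch_3^2`
(`mem_vanishingIdeal_chowSet_three_two_of_mem_highestWeightSpace`), so the numerical multiplicity
`a_χ - dim (HWV_χ ∩ I(Ch_3^2))` is `0`. This is the one row of Prop. 3.15 outside the range `n ≥ m` of
Lemma 3.4. [cite: DorflerIkenmeyerPanova2020, Prop. 3.15 (row 1, arXiv pp. 7–8; TeX multobs.tex L513 {pro:occobsdoexist})] -/
theorem coordRingMultiplicity_chowSet_three_two_222 :
    coordRingMultiplicity k (chowSet k 3 2) 2 (rowDual ![2, 2, 2]) = 0 := by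
  by_contra h
  obtain ⟨F, hF, hFI⟩ := (coordRingMultiplicity_pos_iff two_ne_zero _).mp (Nat.pos_of_ne_zero h)
  exact hFI (mem_vanishingIdeal_chowSet_three_two_of_mem_highestWeightSpace hF)

end Row1

section Prop315Assembled

/-- **Prop. 3.15 from Lemma 3.4 and the printed table alone** (the row-1 Chow side is now PROVED,
`coordRingMultiplicity_chowSet_three_two_222`; the named fact `DIP20_lem_3_4` is consumed BY NAME in
its guarded reading `0 < d`, arXiv p. 5). [cite: DorflerIkenmeyerPanova2020, Prop. 3.15 (arXiv pp. 7–8; TeX multobs.tex L513 {pro:occobsdoexist})] -/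
theorem DIP20_prop_3_15_of_lem_3_4_of_table (h34 : DIP20_lem_3_4) (htab : DIP20_prop_3_15_table) :
    DIP20_prop_3_15 :=
  DIP20_prop_3_15_of_lem_3_4 h34 htab coordRingMultiplicity_chowSet_three_two_222

end Prop315Assembled

section Prop315Unconditional

/-- **Prop. 3.15 from the printed table alone**: Lemma 3.4 is now a theorem of the tree
(`DIP20_lem_3_4_holds`, `DIP20ChowUpperBoundProofs.lean`, val-lit-p6), so Prop. 3.15 follows from
the printed plethysm values `DIP20_prop_3_15_table` with no further hypothesis.
[cite: DorflerIkenmeyerPanova2020, Prop. 3.15 (arXiv pp. 7–8; TeX multobs.tex L513 {pro:occobsdoexist})] -/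
theorem DIP20_prop_3_15_of_table (htab : DIP20_prop_3_15_table) : DIP20_prop_3_15 :=
  DIP20_prop_3_15_of_lem_3_4_of_table DIP20_lem_3_4_holds htab

/-- **Prop. 3.15 from nine plethysm values** (the certificate interface): the five POSITIVITY entries
`a_λ(d[n]) > 0` (power-sum column, via Prop. 3.3) and the four VANISHING entries `a_λ(n[d]) = 0` of
rows 2–5 (Chow column, via Lemma 3.4) of the printed table suffice — row 1's Chow side is
`coordRingMultiplicity_chowSet_three_two_222`, and the exact values `= 1` are not needed. Lower
bounds are certificate-shaped (one explicit highest-weight vector each); the vanishing entries need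
an upper-bound computation. [cite: DorflerIkenmeyerPanova2020, Prop. 3.15 (arXiv pp. 7–8; TeX multobs.tex L513 {pro:occobsdoexist})] -/
theorem DIP20_prop_3_15_of_plethysm_bounds
    (hpos : 0 < plethysmCoeff ℂ (Fin 3) 2 (rowDual ![2, 2, 2]) ∧
      0 < plethysmCoeff ℂ (Fin 3) 3 (rowDual ![7, 3, 2]) ∧
      0 < plethysmCoeff ℂ (Fin 3) 4 (rowDual ![11, 9, 8]) ∧
      0 < plethysmCoeff ℂ (Fin 3) 5 (rowDual ![12, 9, 9]) ∧
      0 < plethysmCoeff ℂ (Fin 4) 6 (rowDual ![14, 14, 13, 13]))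
    (hvan : plethysmCoeff ℂ (Fin 3) 4 (rowDual ![7, 3, 2]) = 0 ∧
      plethysmCoeff ℂ (Fin 3) 7 (rowDual ![11, 9, 8]) = 0 ∧
      plethysmCoeff ℂ (Fin 3) 6 (rowDual ![12, 9, 9]) = 0 ∧
      plethysmCoeff ℂ (Fin 4) 9 (rowDual ![14, 14, 13, 13]) = 0) : DIP20_prop_3_15 := by
  obtain ⟨p1, p2, p3, p4, p5⟩ := hpos
  obtain ⟨a2, a3, a4, a5⟩ := hvan
  have h34 := DIP20_lem_3_4_holds
  refine ⟨⟨coordRingMultiplicity_chowSet_three_two_222, ?_⟩, ⟨?_, ?_⟩, ⟨?_, ?_⟩, ⟨?_, ?_⟩, ⟨?_, ?_⟩⟩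
  · rwa [coordRingMultiplicity_powerSumSet_eq_plethysmCoeff (d := 3) (by norm_num) le_rfl
      (by rw [size_rowDual]; simp [Fin.sum_univ_succ])]
  · refine coordRingMultiplicity_chowSet_eq_zero_of_lem_3_4 h34 le_rfl (by norm_num) [7, 3, 2] ?_ ?_
      (by simp) (by simp) _ ?_ a2
    · intro x hx; simp at hx; omega
    · simp
    · intro i; fin_cases i <;> rfl
  · rwa [coordRingMultiplicity_powerSumSet_eq_plethysmCoeff (d := 4) (by norm_num) le_rfl
      (by rw [size_rowDual]; simp [Fin.sum_univ_succ])]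
  · refine coordRingMultiplicity_chowSet_eq_zero_of_lem_3_4 h34 (by norm_num) (by norm_num)
      [11, 9, 8] ?_ ?_ (by simp) (by simp) _ ?_ a3
    · intro x hx; simp at hx; omega
    · simp
    · intro i; fin_cases i <;> rfl
  · rwa [coordRingMultiplicity_powerSumSet_eq_plethysmCoeff (d := 7) (by norm_num) le_rfl
      (by rw [size_rowDual]; simp [Fin.sum_univ_succ])]
  · refine coordRingMultiplicity_chowSet_eq_zero_of_lem_3_4 h34 (by norm_num) (by norm_num)
      [12, 9, 9] ?_ ?_ (by simp) (by simp) _ ?_ a4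
    · intro x hx; simp at hx; omega
    · simp
    · intro i; fin_cases i <;> rfl
  · rwa [coordRingMultiplicity_powerSumSet_eq_plethysmCoeff (d := 6) (by norm_num) le_rfl
      (by rw [size_rowDual]; simp [Fin.sum_univ_succ])]
  · refine coordRingMultiplicity_chowSet_eq_zero_of_lem_3_4 h34 (by norm_num) (by norm_num)
      [14, 14, 13, 13] ?_ ?_ (by simp) (by simp) _ ?_ a5
    · intro x hx; simp at hx; omega
    · simp
    · intro i; fin_cases i <;> rfl
  · rwa [coordRingMultiplicity_powerSumSet_eq_plethysmCoeff (d := 9) (by norm_num) le_rfl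
      (by rw [size_rowDual]; simp [Fin.sum_univ_succ])]

end Prop315Unconditional

end Literature.Computability.AlgebraicComplexity
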